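import Summits.QuantumFields.QCD.Theses.NestedDissectionSea
import Mathlib.MeasureTheory.Function.AEEqOfIntegral
import HarnessLib

/-!
# Stub `stub_positiveTransfer` of line `birth` — the positive transfer
(crux `Summit.QuantumFields.QCD.Theses.NestedDissectionSea.RobustYangMillsRG`, item
stmt-QuantumFields-17812, namespace `Summit.QuantumFields.QCD.Cruxes.RobustYangMillsRG.Birth`)

`BlockedLawNonneg → PositiveInvariantFormatClustering → GaugeInvariantClustering`: positivity of
the blocked law and the context-free positive core imply gauge-invariant clustering in the
admissible context of the crux.

Mechanism. From `AdmAt`'s pushforward identity (with `Gf := G₁ · G₂ ∘ τ_t`, `G₁`, `G₂ ∘ τ_t`, `1`)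
every `E k S (G ∘ Bl k S)` is the normalised `dens`-expectation on the block torus `M k S`, where
`dens V = exp (−βe k A(V) − W(V)) · F (LF V) V`; `BlockedLawNonneg` (tested on indicators) makes
`dens ≥ 0` a.e., so `dens = exp (−βe k A − W) · |F| (LF V) V` a.e., and `(A, W, |F|)` is again in
the format (`|F| ∅ = 1`, same bound, locality and factorisation by the reverse triangle
inequality) with `0 ≤ |F|`; eventually `β₀ ≤ βe k ≤ βl + 1 ≤ β₁`; apply the core on the torus
`M k S` with the window `[β₀, β₁]` and set `Δ_crux := Δ / ℓ₀`.

The three propositions are the lead's skeleton definitions `Birth.BlockedLawNonneg`,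
`Birth.PositiveInvariantFormatClustering`, `Birth.GaugeInvariantClustering` (crux workfile, not
importable here); they are rendered below as LOCAL NOTATIONS for the verbatim terms, so that the
theorem `stub_positiveTransfer` has literally the registered header and a type definitionally equal
(by `δ`-unfolding) to the skeleton's.
-/

noncomputable section

namespace Summit.QuantumFields.QCD.Cruxes.RobustYangMillsRG.Birth

open scoped BigOperators Topology Manifold Classical MeasureTheory ProbabilityTheory Matrix InnerProductSpace ComplexConjugate ContinuousMap
open Filter Set Function TopologicalSpace MeasureTheory
open Literature.MathematicalPhysics.QuantumLattice Literature.MathematicalPhysics.AQFT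
  Literature.MathematicalPhysics.QuantumFieldTheory

/-! ### The three propositions (verbatim the skeleton's definitions) -/

set_option quotPrecheck false in
/-- Verbatim copy of the skeleton's `Birth.BlockedLawNonneg` (the realisability fact: in the
admissible context, eventually in `k` and for all `S ≥ L k`, the `Bl k S`-pushforward of the signed
fine measure `w k S · μ_N` is a positive measure), as a local notation for the term. [folklore] -/
local notation "BlockedLawNonneg" => (
    let G := ↥(Matrix.specialUnitaryGroup (Fin 3) ℂ); let ρ : G →* Matrix (Fin 3) (Fin 3) ℂ := fundamentalRep (Fin 3); ∀ ε r B₀ κ c₀ cA A₀ : ℝ, 0 < ε → 0 < r → 0 < B₀ → 0 < κ → 0 < c₀ → 0 < cA → 0 < A₀ → ∃ β₀ : ℝ, 0 < β₀ ∧ ∀ (a : ℕ → ℝ) (L : ℕ → ℕ), (∀ k, 0 < a k) → Tendsto a atTop (nhds 0) → Tendsto (fun k => a k * L k) atTop atTop → ∀ ℓ₀ : ℝ, 0 < ℓ₀ → let b : ℕ → ℕ := fun k => ⌊ℓ₀ / a k⌋₊; let N : ℕ → ℕ := fun S => 2 * S + 1; let M : ℕ → ℕ → ℕ := fun k S =>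 N S / b k - 1 + 1; let cor : (k S : ℕ) → Site 4 (M k S) → Site 4 (N S) := fun k S y i => ((N S * (y i).val / M k S : ℕ) : ZMod (N S)); let μ : (n : ℕ) → [NeZero n] → Measure (GaugeConfig 4 n G) := fun _ _ => Measure.pi fun _ => haarProbability G; let LF : (k S : ℕ) → GaugeConfig 4 (M k S) G → Finset (Site 4 (M k S)) := fun _ _ V => Finset.univ.filter fun y => ∃ i j : Fin 4, ε < 3 - (ρ (plaquetteHolonomy V y i j)).trace.re; let AdmAt : ((k S : ℕ) → GaugeConfig 4 (N S) G → ℝ) → (ℕ → ℝ) → ((k S : ℕ) → GaugeConfig 4 (N S) G → GaugeConfig 4 (M k S) G) → ℕ → ℕ → Prop := fun w βe Bl k S => Measurable (w k S) ∧ (0 < ∫ U, w k S U ∂(μ (N S))) ∧ (∀ g U, w k S (gaugeTransform g U) = w k S U) ∧ (∀ v U, w k S (torusConfigShift v U) = w k S U) ∧ (∀ U, w k S (GaugeConfig.timeReflect U) = w k S U) ∧ (∀ (π : Equiv.Perm (Fin 4)) U, w k S (U ∘ fun e => (e.1 ∘ π, π.symm e.2)) = w k S U) ∧ (∀ F : GaugeConfig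 4 (N S) G → ℝ, Measurable F → (∃ C, ∀ U, |F U| ≤ C) → IsPositiveTimeObservable F → 0 ≤ ∫ U, F U.timeReflect * F U * w k S U ∂(μ (N S))) ∧ Measurable (Bl k S) ∧ (∀ g U, Bl k S (gaugeTransform g U) = gaugeTransform (g ∘ cor k S) (Bl k S U)) ∧ (∀ e, DependsOn (fun U => Bl k S U e) {e' | ∀ i, (e'.1 i - cor k S e.1 i).val ≤ 5 * b k ∨ (cor k S e.1 i - e'.1 i).val ≤ 5 * b k}) ∧ ∃ (A W : QuasiLocalGaugePerturbation 4 (M k S) G 1) (F : Finset (Site 4 (M k S)) → GaugeConfig 4 (M k S) G → ℝ), A.HasAnalyticNormLE ρ (smallFieldDomain ρ 1 r ε) κ A₀ ∧ A.NormLE κ A₀ ∧ (∀ X ∈ polymers 1, (∃ V, A.act X V ≠ 0) → ∀ y ∈ X, ∀ y' ∈ X, ∀ i, (y i - y' i).val ≤ X.card ∨ (y' i - y i).val ≤ X.card) ∧ (∀ V, cA * wilsonAction ρ V ≤ A.total V - A.total fun _ => 1) ∧ W.HasAnalyticNormLE ρ (smallFieldDomain ρ 1 r ε) κ B₀ ∧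 W.NormLE κ B₀ ∧ (∀ X ∈ polymers 1, (∃ V, W.act X V ≠ 0) → ∀ y ∈ X, ∀ y' ∈ X, ∀ i, (y i - y' i).val ≤ X.card ∨ (y' i - y i).val ≤ X.card) ∧ (∀ Z, Measurable (F Z)) ∧ (∀ V, F ∅ V = 1) ∧ (∀ Z V, |F Z V| ≤ Real.exp (c₀ * Z.card)) ∧ (∀ Z (n : ℕ) V V', (∀ e, (∃ y ∈ Z, ∀ i, (e.1 i - y i).val ≤ n ∨ (y i - e.1 i).val ≤ n) → V e = V' e) → |F Z V - F Z V'| ≤ Real.exp (c₀ * Z.card + κ * (4 - n))) ∧ (∀ Z₁ Z₂ (n : ℕ), (∀ y ∈ Z₁, ∀ y' ∈ Z₂, ∃ i, n < (y i - y' i).val ∧ n < (y' i - y i).val) → ∀ V, |F (Z₁ ∪ Z₂) V - F Z₁ V * F Z₂ V| ≤ Real.exp (c₀ * (Z₁.card + Z₂.card) + κ * (4 - n))) ∧ ∀ Gf, Measurable Gf → (∃ C, ∀ V, |Gf V| ≤ C) → ∫ U, Gf (Bl k S U) * w k S U ∂(μ (N S)) = ∫ V, Gf V * (Real.exp (-(βe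 k * A.total V) - W.total V) * F (LF k S V) V) ∂(μ (M k S)); ∀ (w : (k S : ℕ) → GaugeConfig 4 (N S) G → ℝ) (βe : ℕ → ℝ) (Bl : (k S : ℕ) → GaugeConfig 4 (N S) G → GaugeConfig 4 (M k S) G), (∃ βl, Tendsto βe atTop (nhds βl)) → (∀ᶠ k in atTop, β₀ ≤ βe k ∧ ∀ S, L k ≤ S → AdmAt w βe Bl k S) → ∀ᶠ k in atTop, ∀ S, L k ≤ S → ∀ Gf : GaugeConfig 4 (M k S) G → ℝ, Measurable Gf → (∃ C, ∀ V, |Gf V| ≤ C) → (∀ V, 0 ≤ Gf V) → 0 ≤ ∫ U, Gf (Bl k S U) * w k S U ∂(μ (N S)))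

set_option quotPrecheck false in
/-- Verbatim copy of the skeleton's `Birth.PositiveInvariantFormatClustering` (the context-free
core: uniform slab clustering of gauge-invariant observables under every normalised POSITIVE
coercive-format density on the block torus, couplings in a window `[β₀, β₁]`), as a local notation
for the term. [folklore] -/
local notation "PositiveInvariantFormatClustering" => (
  let G := ↥(Matrix.specialUnitaryGroup (Fin 3) ℂ)
  let ρ : G →* Matrix (Fin 3) (Fin 3) ℂ := fundamentalRep (Fin 3)
  ∀ ε r B₀ κ c₀ cA A₀ : ℝ, 0 < ε → 0 < r → 0 < B₀ → 0 < κ → 0 < c₀ → 0 < cA → 0 < A₀ →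
  ∃ β₀ : ℝ, 0 < β₀ ∧ ∀ β₁ : ℝ, β₀ ≤ β₁ →
  ∃ Δ : ℝ, 0 < Δ ∧ ∀ h : ℕ, ∃ C : ℝ, ∀ (M : ℕ) [NeZero M],
  let μ : Measure (GaugeConfig 4 M G) := Measure.pi fun _ => haarProbability G
  let LF : GaugeConfig 4 M G → Finset (Site 4 M) := fun V =>
    Finset.univ.filter fun y => ∃ i j : Fin 4, ε < 3 - (ρ (plaquetteHolonomy V y i j)).trace.re
  ∀ (βe : ℝ) (A W : QuasiLocalGaugePerturbation 4 M G 1)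
    (F : Finset (Site 4 M) → GaugeConfig 4 M G → ℝ),
  β₀ ≤ βe → βe ≤ β₁ →
  A.HasAnalyticNormLE ρ (smallFieldDomain ρ 1 r ε) κ A₀ → A.NormLE κ A₀ →
  (∀ X ∈ polymers 1, (∃ V, A.act X V ≠ 0) →
    ∀ y ∈ X, ∀ y' ∈ X, ∀ i, (y i - y' i).val ≤ X.card ∨ (y' i - y i).val ≤ X.card) →
  (∀ V, cA * wilsonAction ρ V ≤ A.total V - A.total fun _ => 1) →
  W.HasAnalyticNormLE ρ (smallFieldDomain ρ 1 r ε) κ B₀ → W.NormLE κ B₀ →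
  (∀ X ∈ polymers 1, (∃ V, W.act X V ≠ 0) →
    ∀ y ∈ X, ∀ y' ∈ X, ∀ i, (y i - y' i).val ≤ X.card ∨ (y' i - y i).val ≤ X.card) →
  (∀ Z, Measurable (F Z)) → (∀ V, F ∅ V = 1) → (∀ Z V, |F Z V| ≤ Real.exp (c₀ * Z.card)) →
  (∀ Z V, 0 ≤ F Z V) →
  (∀ Z (n : ℕ) V V', (∀ e, (∃ y ∈ Z, ∀ i, (e.1 i - y i).val ≤ n ∨ (y i - e.1 i).val ≤ n) →
      V e = V' e) → |F Z V - F Z V'| ≤ Real.exp (c₀ * Z.card + κ * (4 - n))) →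
  (∀ Z₁ Z₂ (n : ℕ), (∀ y ∈ Z₁, ∀ y' ∈ Z₂, ∃ i, n < (y i - y' i).val ∧ n < (y' i - y i).val) →
      ∀ V, |F (Z₁ ∪ Z₂) V - F Z₁ V * F Z₂ V| ≤ Real.exp (c₀ * (Z₁.card + Z₂.card) + κ * (4 - n))) →
  let dens : GaugeConfig 4 M G → ℝ := fun V =>
    Real.exp (-(βe * A.total V) - W.total V) * F (LF V) V
  let E : (GaugeConfig 4 M G → ℝ) → ℝ := fun G₀ => (∫ V, G₀ V * dens V ∂μ) / ∫ V, dens V ∂μ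
  (0 < ∫ V, dens V ∂μ) →
  ∀ (t : ℕ) (G₁ G₂ : GaugeConfig 4 M G → ℝ) (C₁ C₂ : ℝ), 2 * t ≤ M →
  Measurable G₁ → Measurable G₂ → (∀ V, |G₁ V| ≤ C₁) → (∀ V, |G₂ V| ≤ C₂) →
  (∀ g V, G₁ (gaugeTransform g V) = G₁ V) → (∀ g V, G₂ (gaugeTransform g V) = G₂ V) →
  DependsOn G₁ {e | (e.1 0).val < h} → DependsOn G₂ {e | (e.1 0).val < h} →
  |E (fun V => G₁ V * G₂ (torusConfigShift (Pi.single 0 (t : ZMod M)) V))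
    - E G₁ * E (fun V => G₂ (torusConfigShift (Pi.single 0 (t : ZMod M)) V))|
    ≤ C * C₁ * C₂ * Real.exp (-(Δ * t)))

set_option quotPrecheck false in
/-- Verbatim copy of the skeleton's `Birth.GaugeInvariantClustering` (the crux's conclusion for
block-gauge-invariant slab observables, in the admissible context), as a local notation for the
term. [folklore] -/
local notation "GaugeInvariantClustering" => (
    let G := ↥(Matrix.specialUnitaryGroup (Fin 3) ℂ); let ρ : G →* Matrix (Fin 3) (Fin 3) ℂ := fundamentalRep (Fin 3); ∀ ε r B₀ κ c₀ cA A₀ : ℝ, 0 < ε → 0 < r → 0 < B₀ → 0 < κ → 0 < c₀ → 0 < cA → 0 < A₀ → ∃ β₀ : ℝ, 0 < β₀ ∧ ∀ (a : ℕ → ℝ) (L : ℕ → ℕ), (∀ k, 0 < a k) → Tendsto a atTop (nhds 0) → Tendsto (fun k => a k * L k) atTop atTop → ∀ ℓ₀ : ℝ, 0 < ℓ₀ → let b : ℕ → ℕ := fun k => ⌊ℓ₀ / a k⌋₊; let N : ℕ → ℕ := fun S => 2 * S + 1; let M : ℕ → ℕ → ℕ := fun k S => N S / b k - 1 + 1;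 let cor : (k S : ℕ) → Site 4 (M k S) → Site 4 (N S) := fun k S y i => ((N S * (y i).val / M k S : ℕ) : ZMod (N S)); let μ : (n : ℕ) → [NeZero n] → Measure (GaugeConfig 4 n G) := fun _ _ => Measure.pi fun _ => haarProbability G; let LF : (k S : ℕ) → GaugeConfig 4 (M k S) G → Finset (Site 4 (M k S)) := fun _ _ V => Finset.univ.filter fun y => ∃ i j : Fin 4, ε < 3 - (ρ (plaquetteHolonomy V y i j)).trace.re; let AdmAt : ((k S : ℕ) → GaugeConfig 4 (N S) G → ℝ) → (ℕ → ℝ) → ((k S : ℕ) → GaugeConfig 4 (N S) G → GaugeConfig 4 (M k S) G) → ℕ → ℕ → Prop := fun w βe Bl k S => Measurable (w k S) ∧ (0 < ∫ U, w k S U ∂(μ (N S))) ∧ (∀ g U, w k S (gaugeTransform g U) = w k S U) ∧ (∀ v U, w k S (torusConfigShift v U) = w k S U) ∧ (∀ U, w k S (GaugeConfig.timeReflect U) = w k S U) ∧ (∀ (π : Equiv.Perm (Fin 4)) U, w k S (U ∘ fun e => (e.1 ∘ π, π.symm e.2)) = w k S U) ∧ (∀ F : GaugeConfig 4 (N S)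 G → ℝ, Measurable F → (∃ C, ∀ U, |F U| ≤ C) → IsPositiveTimeObservable F → 0 ≤ ∫ U, F U.timeReflect * F U * w k S U ∂(μ (N S))) ∧ Measurable (Bl k S) ∧ (∀ g U, Bl k S (gaugeTransform g U) = gaugeTransform (g ∘ cor k S) (Bl k S U)) ∧ (∀ e, DependsOn (fun U => Bl k S U e) {e' | ∀ i, (e'.1 i - cor k S e.1 i).val ≤ 5 * b k ∨ (cor k S e.1 i - e'.1 i).val ≤ 5 * b k}) ∧ ∃ (A W : QuasiLocalGaugePerturbation 4 (M k S) G 1) (F : Finset (Site 4 (M k S)) → GaugeConfig 4 (M k S) G → ℝ), A.HasAnalyticNormLE ρ (smallFieldDomain ρ 1 r ε) κ A₀ ∧ A.NormLE κ A₀ ∧ (∀ X ∈ polymers 1, (∃ V, A.act X V ≠ 0) → ∀ y ∈ X, ∀ y' ∈ X, ∀ i, (y i - y' i).val ≤ X.card ∨ (y' i - y i).val ≤ X.card) ∧ (∀ V, cA * wilsonAction ρ V ≤ A.total V - A.total fun _ => 1) ∧ W.HasAnalyticNormLE ρ (smallFieldDomain ρ 1 r ε) κ B₀ ∧ W.NormLE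 κ B₀ ∧ (∀ X ∈ polymers 1, (∃ V, W.act X V ≠ 0) → ∀ y ∈ X, ∀ y' ∈ X, ∀ i, (y i - y' i).val ≤ X.card ∨ (y' i - y i).val ≤ X.card) ∧ (∀ Z, Measurable (F Z)) ∧ (∀ V, F ∅ V = 1) ∧ (∀ Z V, |F Z V| ≤ Real.exp (c₀ * Z.card)) ∧ (∀ Z (n : ℕ) V V', (∀ e, (∃ y ∈ Z, ∀ i, (e.1 i - y i).val ≤ n ∨ (y i - e.1 i).val ≤ n) → V e = V' e) → |F Z V - F Z V'| ≤ Real.exp (c₀ * Z.card + κ * (4 - n))) ∧ (∀ Z₁ Z₂ (n : ℕ), (∀ y ∈ Z₁, ∀ y' ∈ Z₂, ∃ i, n < (y i - y' i).val ∧ n < (y' i - y i).val) → ∀ V, |F (Z₁ ∪ Z₂) V - F Z₁ V * F Z₂ V| ≤ Real.exp (c₀ * (Z₁.card + Z₂.card) + κ * (4 - n))) ∧ ∀ Gf, Measurable Gf → (∃ C, ∀ V, |Gf V| ≤ C) → ∫ U, Gf (Bl k S U) * w k S U ∂(μ (N S)) = ∫ V, Gf V * (Real.exp (-(βe k * A.total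 V) - W.total V) * F (LF k S V) V) ∂(μ (M k S)); ∀ (w : (k S : ℕ) → GaugeConfig 4 (N S) G → ℝ) (βe : ℕ → ℝ) (Bl : (k S : ℕ) → GaugeConfig 4 (N S) G → GaugeConfig 4 (M k S) G), (∃ βl, Tendsto βe atTop (nhds βl)) → (∀ᶠ k in atTop, β₀ ≤ βe k ∧ ∀ S, L k ≤ S → AdmAt w βe Bl k S) → let E : (k S : ℕ) → (GaugeConfig 4 (N S) G → ℝ) → ℝ := fun k S h => (∫ U, h U * w k S U ∂(μ (N S))) / ∫ U, w k S U ∂(μ (N S)); ∃ Δ : ℝ, 0 < Δ ∧ ∀ h : ℕ, ∃ C : ℝ, ∀ᶠ k in atTop, ∀ S, L k ≤ S → ∀ (t : ℕ) (G₁ G₂ : GaugeConfig 4 (M k S) G → ℝ) (C₁ C₂ : ℝ), 2 * t ≤ M k S → Measurable G₁ → Measurable G₂ → (∀ V, |G₁ V| ≤ C₁) → (∀ V, |G₂ V| ≤ C₂) → (∀ g V, G₁ (gaugeTransform g V) = G₁ V) → (∀ g V, G₂ (gaugeTransform g V) = G₂ V) → DependsOn G₁ {e | (e.1 0).val < h}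 → DependsOn G₂ {e | (e.1 0).val < h} → |E k S (fun U => G₁ (Bl k S U) * G₂ (torusConfigShift (Pi.single 0 (t : ZMod (M k S))) (Bl k S U))) - E k S (fun U => G₁ (Bl k S U)) * E k S (fun U => G₂ (torusConfigShift (Pi.single 0 (t : ZMod (M k S))) (Bl k S U)))| ≤ C * C₁ * C₂ * Real.exp (-(Δ * (ℓ₀ * t))))

/-! ### The one-volume transfer -/

namespace PositiveTransfer

/-- **Positivity of the pushforward functional makes the density non-negative a.e.** (one volume,
abstract measure spaces). If the signed weight `w` has `0 < ∫ w`, the functional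
`Gf ↦ ∫ Gf (Bl U) w U` is non-negative on bounded measurable `Gf ≥ 0`, and it is represented by the
density `ex · Fv` with `ex > 0` (`∫ Gf (Bl U) w U = ∫ Gf V (ex V Fv V)` for bounded measurable `Gf`),
then `ex · |Fv|` has positive total mass and represents the NORMALISED functional:
`(∫ Gf (Bl U) w U) / ∫ w = (∫ Gf V ex V |Fv V|) / ∫ ex V |Fv V|`. Proof: `Gf = 1` shows `ex · Fv` is
integrable with integral `∫ w > 0`; indicators show `0 ≤ ∫_s ex · Fv` for every measurable `s`, so
`0 ≤ ex · Fv` a.e. (`ae_nonneg_of_forall_setIntegral_nonneg`), i.e. `ex · |Fv| = ex · Fv` a.e.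
[folklore] -/
theorem normalised_eq_of_nonneg {ΩN ΩM : Type*} [MeasurableSpace ΩN] [MeasurableSpace ΩM]
    {μN : Measure ΩN} {μM : Measure ΩM} {w : ΩN → ℝ} {Bl : ΩN → ΩM} {ex Fv : ΩM → ℝ}
    (hex : ∀ V, 0 < ex V) (hwpos : 0 < ∫ U, w U ∂μN)
    (hpos : ∀ Gf : ΩM → ℝ, Measurable Gf → (∃ C, ∀ V, |Gf V| ≤ C) → (∀ V, 0 ≤ Gf V) →
      0 ≤ ∫ U, Gf (Bl U) * w U ∂μN)
    (hpush : ∀ Gf : ΩM → ℝ, Measurable Gf → (∃ C, ∀ V, |Gf V| ≤ C) →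
      ∫ U, Gf (Bl U) * w U ∂μN = ∫ V, Gf V * (ex V * Fv V) ∂μM) :
    (0 < ∫ V, ex V * |Fv V| ∂μM) ∧
      ∀ Gf : ΩM → ℝ, Measurable Gf → (∃ C, ∀ V, |Gf V| ≤ C) →
        (∫ U, Gf (Bl U) * w U ∂μN) / (∫ U, w U ∂μN) =
          (∫ V, Gf V * (ex V * |Fv V|) ∂μM) / ∫ V, ex V * |Fv V| ∂μM := by
  -- total mass: `∫ w = ∫ ex · Fv`
  have h1 : ∫ U, w U ∂μN = ∫ V, ex V * Fv V ∂μM := by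
    have h := hpush (fun _ => 1) measurable_const ⟨1, fun _ => abs_one.le⟩
    simpa only [one_mul] using h
  -- hence `ex · Fv` is integrable
  have hint : Integrable (fun V => ex V * Fv V) μM := by
    by_contra hni
    rw [h1, integral_undef hni] at hwpos
    exact lt_irrefl _ hwpos
  -- and non-negative a.e. (test the positivity on indicators)
  have hae : 0 ≤ᵐ[μM] fun V => ex V * Fv V := by
    refine ae_nonneg_of_forall_setIntegral_nonneg hint fun s hs _ => ?_
    have hGm : Measurable (s.indicator fun _ => (1 : ℝ)) := measurable_const.indicator hs
    have hGb : ∃ C : ℝ, ∀ V, |s.indicator (fun _ => (1 : ℝ)) V| ≤ C :=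
      ⟨1, fun V => by by_cases hV : V ∈ s <;> simp [hV]⟩
    have hG0 : ∀ V, 0 ≤ s.indicator (fun _ => (1 : ℝ)) V :=
      fun V => Set.indicator_nonneg (fun _ _ => zero_le_one) V
    have h2 := hpos _ hGm hGb hG0
    rw [hpush _ hGm hGb] at h2
    have h3 : (fun V => s.indicator (fun _ => (1 : ℝ)) V * (ex V * Fv V)) =
        s.indicator fun V => ex V * Fv V := by
      funext V
      by_cases hV : V ∈ s <;> simp [hV]
    rwa [h3, integral_indicator hs] at h2
  -- so `ex · |Fv| = ex · Fv` a.e.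
  have habs : ∀ᵐ V ∂μM, ex V * |Fv V| = ex V * Fv V := by
    filter_upwards [hae] with V hV
    have hV' : 0 ≤ ex V * Fv V := hV
    rw [abs_of_nonneg ((mul_nonneg_iff_of_pos_left (hex V)).1 hV')]
  have hI : ∫ V, ex V * |Fv V| ∂μM = ∫ V, ex V * Fv V ∂μM := integral_congr_ae habs
  refine ⟨?_, fun Gf hGm hGb => ?_⟩
  · rw [hI, ← h1]
    exact hwpos
  · have hG : ∫ V, Gf V * (ex V * |Fv V|) ∂μM = ∫ V, Gf V * (ex V * Fv V) ∂μM := by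
      refine integral_congr_ae ?_
      filter_upwards [habs] with V hV
      rw [hV]
    rw [hpush Gf hGm hGb, h1, hG, hI]

end PositiveTransfer

/-! ### The stub -/

/-- **Stub 2″ — the positive transfer**: positivity of the blocked law and the context-free
positive core imply gauge-invariant clustering in the admissible context. From `AdmAt`'s
pushforward identity every `E k S (G ∘ Bl k S)` is the normalised expectation of the density
`dens = exp (−βe k A − W) · F (LF V) V` on the block torus `M k S`; `BlockedLawNonneg` makes
`dens ≥ 0` a.e. (`PositiveTransfer.normalised_eq_of_nonneg`), so the density may be replaced by
`exp (−βe k A − W) · |F| (LF V) V`, and `(A, W, |F|)` is in the positive format (`|F| ∅ = 1`, same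
bound, locality and factorisation by the reverse triangle inequality, `0 ≤ |F|`); eventually
`β₀ ≤ βe k ≤ βl + 1 ≤ β₁`, so the core applies on the torus `M k S` in the window `[β₀, β₁]`, and
`Δ_crux := Δ / ℓ₀`. [folklore] -/
theorem stub_positiveTransfer : BlockedLawNonneg → PositiveInvariantFormatClustering → GaugeInvariantClustering := by
  intro hBLN hPIFC G ρ ε r B₀ κ c₀ cA A₀ hε hr hB₀ hκ hc₀ hcA hA₀
  obtain ⟨β₀', hβ₀', HP⟩ := hPIFC ε r B₀ κ c₀ cA A₀ hε hr hB₀ hκ hc₀ hcA hA₀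
  obtain ⟨β₀'', -, HB⟩ := hBLN ε r B₀ κ c₀ cA A₀ hε hr hB₀ hκ hc₀ hcA hA₀
  refine ⟨max β₀' β₀'', lt_max_of_lt_left hβ₀', ?_⟩
  intro a L ha ha0 haL ℓ₀ hℓ₀ b N M cor μ LF AdmAt w βe Bl hβe hadm E
  obtain ⟨βl, hβl⟩ := hβe
  -- the window `[β₀', β₁]`, `β₁ := max β₀' (βl + 1)`, and the rate `Δ' / ℓ₀`
  obtain ⟨Δ', hΔ', HP⟩ := HP (max β₀' (βl + 1)) (le_max_left _ _)
  refine ⟨Δ' / ℓ₀, div_pos hΔ' hℓ₀, fun h => ?_⟩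
  obtain ⟨C', HP⟩ := HP h
  refine ⟨C', ?_⟩
  -- eventually: admissibility, positivity of the blocked law, and `βe k ≤ βl + 1`
  have HBk := HB a L ha ha0 haL ℓ₀ hℓ₀ w βe Bl ⟨βl, hβl⟩
    (hadm.mono fun k hk => ⟨(le_max_right _ _).trans hk.1, hk.2⟩)
  have hβup : ∀ᶠ k in atTop, βe k ∈ Iic (βl + 1) := hβl.eventually (Iic_mem_nhds (lt_add_one βl))
  filter_upwards [hadm, HBk, hβup] with k hk hBk hβk
  intro S hS t G₁ G₂ C₁ C₂ h2t hG₁m hG₂m hG₁b hG₂b hG₁i hG₂i hG₁d hG₂d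
  obtain ⟨-, hwpos, -, -, -, -, -, -, -, -, A, W, F, hAan, hAn, hAr, hAc, hWan, hWn, hWr, hFm, hF0,
    hFb, hFl, hFf, hpush⟩ := hk.2 S hS
  have hβlo : β₀' ≤ βe k := (le_max_left _ _).trans hk.1
  have hβhi : βe k ≤ max β₀' (βl + 1) := (Set.mem_Iic.1 hβk).trans (le_max_right _ _)
  -- the `|F|`-repair: `(A, W, |F|)` is in the positive format
  have hF'm : ∀ Z, Measurable fun V => |F Z V| := fun Z => continuous_abs.measurable.comp (hFm Z)
  have hF'0 : ∀ V, |F ∅ V| = 1 := fun V => by rw [hF0 V, abs_one]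
  have hF'b : ∀ Z V, |(|F Z V|)| ≤ Real.exp (c₀ * Z.card) := fun Z V => by
    rw [abs_abs]; exact hFb Z V
  have hF'pos : ∀ Z V, 0 ≤ |F Z V| := fun Z V => abs_nonneg _
  have hF'l : ∀ Z (n : ℕ) V V', (∀ e, (∃ y ∈ Z, ∀ i, (e.1 i - y i).val ≤ n ∨ (y i - e.1 i).val ≤ n) →
      V e = V' e) → |(|F Z V|) - (|F Z V'|)| ≤ Real.exp (c₀ * Z.card + κ * (4 - n)) :=
    fun Z n V V' hVV' => (abs_abs_sub_abs_le_abs_sub _ _).trans (hFl Z n V V' hVV')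
  have hF'f : ∀ Z₁ Z₂ (n : ℕ), (∀ y ∈ Z₁, ∀ y' ∈ Z₂, ∃ i, n < (y i - y' i).val ∧ n < (y' i - y i).val) →
      ∀ V, |(|F (Z₁ ∪ Z₂) V|) - |F Z₁ V| * (|F Z₂ V|)| ≤
        Real.exp (c₀ * (Z₁.card + Z₂.card) + κ * (4 - n)) := fun Z₁ Z₂ n hsep V => by
    rw [← abs_mul]; exact (abs_abs_sub_abs_le_abs_sub _ _).trans (hFf Z₁ Z₂ n hsep V)
  -- positivity a.e. of the pushforward density and the transfer of normalised expectations
  obtain ⟨hpos', hE'⟩ := PositiveTransfer.normalised_eq_of_nonneg (μN := μ (N S)) (μM := μ (M k S))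
    (w := w k S) (Bl := Bl k S) (ex := fun V => Real.exp (-(βe k * A.total V) - W.total V))
    (Fv := fun V => F (LF k S V) V) (fun V => Real.exp_pos _) hwpos (hBk S hS) hpush
  -- the core on the block torus `M k S` for the positive format `(A, W, |F|)`
  have key := HP (M k S) (βe k) A W (fun Z V => |F Z V|) hβlo hβhi hAan hAn hAr hAc hWan hWn hWr
    hF'm hF'0 hF'b hF'pos hF'l hF'f hpos' t G₁ G₂ C₁ C₂ h2t hG₁m hG₂m hG₁b hG₂b hG₁i hG₂i hG₁d hG₂d
  -- the three normalised expectations of the crux are those of the positive format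
  have hC₁ : 0 ≤ C₁ := (abs_nonneg _).trans (hG₁b fun _ => 1)
  have hτm : Measurable fun V => G₂ (torusConfigShift (Pi.single 0 (t : ZMod (M k S))) V) :=
    hG₂m.comp (torusConfigShift _).measurable
  have hpm : Measurable fun V => G₁ V * G₂ (torusConfigShift (Pi.single 0 (t : ZMod (M k S))) V) :=
    hG₁m.mul hτm
  have hpb : ∃ C, ∀ V, |G₁ V * G₂ (torusConfigShift (Pi.single 0 (t : ZMod (M k S))) V)| ≤ C :=
    ⟨C₁ * C₂, fun V => by
      rw [abs_mul]; exact mul_le_mul (hG₁b _) (hG₂b _) (abs_nonneg _) hC₁⟩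
  have hEdef : ∀ f, E k S f = (∫ U, f U * w k S U ∂(μ (N S))) / ∫ U, w k S U ∂(μ (N S)) :=
    fun f => rfl
  have hrate : Δ' / ℓ₀ * (ℓ₀ * (t : ℝ)) = Δ' * t := by
    rw [← mul_assoc, div_mul_cancel₀ Δ' hℓ₀.ne']
  rw [hEdef, hEdef, hEdef, hE' _ hpm hpb, hE' _ hG₁m ⟨C₁, hG₁b⟩, hE' _ hτm ⟨C₂, fun V => hG₂b _⟩,
    hrate]
  exact key

end Summit.QuantumFields.QCD.Cruxes.RobustYangMillsRG.Birth
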